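import Summits.BirchSwinnertonDyer.BirchSwinnertonDyer.Theorems.ErratumRoadFiveFixedPartOfThm326
import Summits.BirchSwinnertonDyer.BirchSwinnertonDyer.Theorems.ErratumRoadFiveLocalDefectOfFiniteFixed
import HarnessLib

/-!
# S2♭♭ ⇐ [Wiles 1988 Thm 2.2]: the REGISTERED v4 stub `stub_localDefectFiniteAnomalous` of line `erratum_chain` (crux 25505) behind the
# named fact `Hida2000_thm326_ordinary_unitRoot` (helper, `--supports stmt-BirchSwinnertonDyer-25505`)

Cell `bsd-stepL`, seat `bsd-stepL-imc-p1` (prover g23, 2026-08-28). Theorems only. One line: (FIX) ⇐ [W]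
(`FixFinal.finiteFixedPartAnomalous_of_thm326`, `ErratumRoadFiveFixedPartOfThm326`) composed with (FIX) ⇒ S2♭♭
(`LocalDefectAtData.stub_localDefectFiniteAnomalous_of_finiteFixed`, `ErratumRoadFiveLocalDefectOfFiniteFixed`). With the registered
line v4 (`Cruxes/ErratumThm23SigmaLe/Lines/erratum_chain.lean`: `_of hFW hLoc := ErratumChainV4.erratumThm23SigmaLe_of_twoVarCore_of_localDefect hFW hLoc`)
this makes the crux `ErratumThm23SigmaLe` follow from S1 (`stub_FW21_twoVarSigmaLePinned`) and the printed theorem [Wiles 1988 Thm 2.2] alone.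

* `stub_localDefectFiniteAnomalous_of_thm326` — `Hida2000_thm326_ordinary_unitRoot → S2♭♭` (the registered stub statement verbatim after `→`).

HONEST FRAMING: conditional on the unproved named fact `Hida2000_thm326_ordinary_unitRoot` (Wiles 1988 Thm 2.2 ∕ Hida 2000 Thm 3.26 (2));
closes: none (T7) — the registered stub has no such hypothesis; BSD is proved for no pair.

## References
* [JetchevSkinnerWan2017] §3.4 L.3.4.1; [Wiles1988] Thm 2.2; [Hida2000] Thm 3.26.
-/

noncomputable section

-- D-0017: single-problem summit, the namespace repeats the problem name by design.
set_option linter.dupNamespace false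
set_option autoImplicit false

open scoped Classical
open PowerSeries NumberField IsDedekindDomain Field
  Literature.NumberTheory.GaloisRepresentations Literature.NumberTheory.EllipticCurves
  Literature.NumberTheory.EllipticCurves.ModularForms Literature.NumberTheory.EllipticCurves.BigGaloisRep
  Literature.NumberTheory.EllipticCurves.GreenbergSelmer Literature.NumberTheory.EllipticCurves.BigRepModule

namespace Summit.BirchSwinnertonDyer.BirchSwinnertonDyer.Theorems.ErratumThm23TwoVariable.FixFinal

/-- **S2♭♭ granted [Wiles 1988 Thm 2.2]**: finiteness of the local control defect `𝓜^{Γ_{K_𝔭̄}}/T_c` on the `¬(dec)` corner — the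
registered v4 stub `stub_localDefectFiniteAnomalous` verbatim, behind `Hida2000_thm326_ordinary_unitRoot`.
[cite: JetchevSkinnerWan2017, §3.4 Lemma 3.4.1 (arXiv:1512.06894 p. 14)] [cite: Wiles1988, Thm. 2.2] -/
theorem stub_localDefectFiniteAnomalous_of_thm326 (hW : Hida2000_thm326_ordinary_unitRoot) :

    ∀ {p : ℕ} [Fact p.Prime] {M : ℕ} [NeZero M] {k : ℤ}
      (g : CuspForm (CongruenceSubgroup.Gamma0 M) k) (ιg : coeffField g →+* PadicAlgCl p)
      (Δ : OrdinaryNewformDatum g p ιg)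
      (K : Type) [Field K] [NumberField K] (𝔭bar : HeightOneSpectrum (𝓞 K)) (κ : ZpExtension K p)
      (γ : absoluteGaloisGroup K) [Fact (κ.IsTopGenerator γ)] (S : Finset (HeightOneSpectrum (𝓞 K))),
      IsNewform0 g → 2 ≤ k → Even k → ¬ p ∣ M → 3 < p →
      ‖ιg ⟨(UpperHalfPlane.qExpansion 1 ⇑g).coeff p, coeff_mem_coeffField g p⟩‖ = 1 →
      IsImaginaryQuadratic K → ((Ideal.span {(p : ℤ)}).primesOver (𝓞 K)).ncard = 2 →
      ((p : ℕ) : 𝓞 K) ∈ 𝔭bar.asIdeal →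
      SkinnerUrban2014.IsResiduallyIrreducible Δ →
      (∃ v : HeightOneSpectrum (𝓞 ℚ), SkinnerUrban2014.IsResiduallyRamifiedAt Δ v ∧
        ((Rat.HeightOneSpectrum.primesEquiv v : Nat.Primes) : ℕ) ∣ M ∧
        ¬ ((Rat.HeightOneSpectrum.primesEquiv v : Nat.Primes) : ℕ) ^ 2 ∣ M ∧
        ((Ideal.span {(((Rat.HeightOneSpectrum.primesEquiv v : Nat.Primes) : ℕ) : ℤ)}).primesOver (𝓞 K)).ncard ≠ 2) →
      κ.IsAnticyclotomic → (∀ w ∈ S, ((p : ℕ) : 𝓞 K) ∉ w.asIdeal) →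
      (∀ w : HeightOneSpectrum (𝓞 K), ((M : ℕ) : 𝓞 K) ∈ w.asIdeal → w ∈ S) →
      -- the corner `¬(dec)`: a non-zero `Γ_{K_𝔭̄}`-fixed `p`-power-torsion element of `A_g` ("anomalous at `𝔭̄`")
      ¬ (∀ a : Cofree Δ.ρ (padicCoeffField ιg),
          (∀ σ : LocalGroup K (Sum.inl 𝔭bar), (Δ.cofreeRepOver K) (localMap K (Sum.inl 𝔭bar) σ) a = a) →
          (∃ j : ℕ, p ^ j • a = 0) → a = 0) →
      -- the complementary CYCLOTOMIC direction `κ'` with a generator `γ'`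
      ∀ (κ' : ZpExtension K p) (γ' : absoluteGaloisGroup K) [Fact (κ'.IsTopGenerator γ')], κ'.IsCyclotomic →
      ∀ [TopologicalSpace (PowerSeries (padicCoeffIntegers ιg))]
        [ContinuousSMul (PowerSeries (padicCoeffIntegers ιg))
          (BigRepModule (padicCoeffIntegers ιg) p (Cofree Δ.ρ (padicCoeffField ιg)))]
        [TopologicalSpace (PowerSeries (PowerSeries (padicCoeffIntegers ιg)))]
        [ContinuousSMul (PowerSeries (PowerSeries (padicCoeffIntegers ιg)))
          (BigRepModule (PowerSeries (padicCoeffIntegers ιg)) p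
            (BigRepModule (padicCoeffIntegers ιg) p (Cofree Δ.ρ (padicCoeffField ιg))))],
      -- the LOCAL control defect at the strict prime is FINITE: `𝓜^{Γ_{K_𝔭̄}}/T_c 𝓜^{Γ_{K_𝔭̄}}` finite
      Finite (QuotSMulTop (PowerSeries.X : PowerSeries (PowerSeries (padicCoeffIntegers ιg)))
        ↥((((AnticyclotomicBigGaloisRep κ' (AnticyclotomicBigGaloisRep κ (Δ.cofreeRepOver K))).restrict
          (localMap K (Sum.inl 𝔭bar))).toTopRep).ρ.invariants)) :=
  LocalDefectAtData.stub_localDefectFiniteAnomalous_of_finiteFixed (finiteFixedPartAnomalous_of_thm326 hW)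

end Summit.BirchSwinnertonDyer.BirchSwinnertonDyer.Theorems.ErratumThm23TwoVariable.FixFinal

end
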